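import Summits.AtomisticToContinuum.Crystallization.Theorems.ChargedEnergyGapTableQ
import Summits.AtomisticToContinuum.Crystallization.Theorems.ChargedEnergyGapCostCell
import Summits.AtomisticToContinuum.Crystallization.Theorems.ChargedEnergyGapCapFloor
import HarnessLib

/-!
# NODE 108 «CellChecker» (lens-3 g92), PART B «CellKernel» — the rational kernel and the CAP side of a cost-cell certificate

Door D1 (critic row 1637 (B)).  Everything a (D¹)/(T¹ᶜ) cost-cell certificate asserts is a closed RATIONAL inequality; this file provides the
exact-ℚ mirrors the kernel evaluates (`decide +kernel`, standard axioms) together with their cast identities to the tree's real definitions: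

* §108B.1 `clamp01Q` / `smoothStepQ` / `depthProfileQ` (= `depthProfile`, which IS rational-valued: `smoothStep` is a clamped polynomial),
  `tiltArgQ` (= `tiltArg`), `kappaQ` (= `max 1 (min 2 ((116 − hi)/3))`), `capMinorantQ` (= `capMinorant`) — each with `cast_…`.
* §108B.2 ONE six-column representation lemma `roofVal_T75_le_six` (tree E8 `roofVal_T75_le_of_repr` with the `Fin 6` families spelled out),
  the form the corner check of PART C discharges.
* §108B.3 the CAP-SIDE checks of a cell on one axis, as `Bool`-valued functions of rationals — `capGeomCheck` (= `CapCellGeom`), `poleRowCheck`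
  (= `PoleRowCert`), `tiltRowCheck c` (= `TiltRowCert c`) — and their soundness lemmas (`…_sound`: `check = true →` the real certificate at the casts),
  proved by `decide_eq_true_eq` + `Rat.cast` bookkeeping only.  PART C assembles them with NODE 99 `capCell_lower` / NODE 101 `domCapK_ge_floor`.

No analysis, no new mathematics: the content is NODES 97–101/105–107; this is their reflection to data.  No placeholders.
-/

namespace Summit.AtomisticToContinuum.Crystallization.Theorems.ChargedEnergyGapChartDial

/-! ## §108B.1 The rational kernel -/

/-- `max 0 (min 1 x)` on `ℚ`, by two comparisons. -/
def clamp01Q (x : ℚ) : ℚ := if x ≤ 0 then 0 else if 1 ≤ x then 1 else x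

/-- [cast] `clamp01Q` is `max 0 (min 1 ·)`. -/
theorem cast_clamp01Q (x : ℚ) : ((clamp01Q x : ℚ) : ℝ) = max 0 (min 1 (x : ℝ)) := by
  unfold clamp01Q
  split_ifs with h h'
  · have hx : (x : ℝ) ≤ 0 := by exact_mod_cast h
    rw [Rat.cast_zero, max_eq_left ((min_le_right _ _).trans hx)]
  · have hx : (1 : ℝ) ≤ x := by exact_mod_cast h'
    rw [Rat.cast_one, min_eq_left hx, max_eq_right (zero_le_one' ℝ)]
  · have h0 : (0 : ℝ) ≤ x := by exact_mod_cast (not_le.mp h).le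
    have h1 : (x : ℝ) ≤ 1 := by exact_mod_cast (not_le.mp h').le
    rw [min_eq_right h1, max_eq_right h0]

/-- The smooth step `S₇` on `ℚ` (clamped septic polynomial; exact). -/
def smoothStepQ (t : ℚ) : ℚ :=
  clamp01Q t ^ 4 * (35 - 84 * clamp01Q t + 70 * clamp01Q t ^ 2 - 20 * clamp01Q t ^ 3)

/-- [cast] `smoothStepQ` is `smoothStep`. -/
theorem cast_smoothStepQ (t : ℚ) : ((smoothStepQ t : ℚ) : ℝ) = smoothStep t := by
  simp only [smoothStepQ, smoothStep, Rat.cast_mul, Rat.cast_sub, Rat.cast_add, Rat.cast_pow, Rat.cast_ofNat, cast_clamp01Q]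

/-- The depth profile `φ(t) = (1 − S₇(2 − 2t/ϱ))⁴` on `ℚ` (exact: `φ` is rational-valued at rational depths). -/
def depthProfileQ (ϱ t : ℚ) : ℚ := (1 - smoothStepQ (2 - 2 * t / ϱ)) ^ 4

/-- ★ [cast] `depthProfileQ` is `depthProfile`: the weight box of a cell is evaluated EXACTLY by the kernel, no bracketing. -/
theorem cast_depthProfileQ (ϱ t : ℚ) : ((depthProfileQ ϱ t : ℚ) : ℝ) = depthProfile ϱ t := by
  simp only [depthProfileQ, depthProfile, Rat.cast_pow, Rat.cast_sub, Rat.cast_one, cast_smoothStepQ, Rat.cast_mul, Rat.cast_div,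
    Rat.cast_ofNat]

/-- The tilt argument `q_c(ρ, d) = (d − ρ)² + 2ρ² + 2(d − ρ)ρc` on `ℚ`. -/
def tiltArgQ (c ρ d : ℚ) : ℚ := (d - ρ) ^ 2 + 2 * ρ ^ 2 + 2 * (d - ρ) * ρ * c

/-- [cast] `tiltArgQ` is `tiltArg`. -/
theorem cast_tiltArgQ (c ρ d : ℚ) : ((tiltArgQ c ρ d : ℚ) : ℝ) = tiltArg c ρ d := by
  simp only [tiltArgQ, tiltArg]; push_cast; ring

/-- The cell value of the domino factor `κ(hi) = max 1 (min 2 ((116 − hi)/3))` on `ℚ`. -/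
def kappaQ (hi : ℚ) : ℚ := max 1 (min 2 ((116 - hi) / 3))

/-- [cast] `kappaQ`. -/
theorem cast_kappaQ (hi : ℚ) : ((kappaQ hi : ℚ) : ℝ) = max 1 (min 2 ((116 - (hi : ℝ)) / 3)) := by
  simp only [kappaQ, Rat.cast_max, Rat.cast_min, Rat.cast_div, Rat.cast_sub, Rat.cast_ofNat, Rat.cast_one]

/-- NODE 99's affine cap minorant on `ℚ`. -/
def capMinorantQ (y₀ y₁ y₂ y₃ p₀ p₁ l₀₁ l₁₁ l₀₂ l₁₂ l₀₃ l₁₃ t ρ : ℚ) : ℚ :=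
  y₀ * (p₀ + p₁ * (t - ρ)) + y₁ * (l₀₁ + l₁₁ * t) + y₂ * (l₀₂ + l₁₂ * t) + y₃ * (l₀₃ + l₁₃ * t)

/-- [cast] `capMinorantQ` is `capMinorant`. -/
theorem cast_capMinorantQ (y₀ y₁ y₂ y₃ p₀ p₁ l₀₁ l₁₁ l₀₂ l₁₂ l₀₃ l₁₃ t ρ : ℚ) :
    ((capMinorantQ y₀ y₁ y₂ y₃ p₀ p₁ l₀₁ l₁₁ l₀₂ l₁₂ l₀₃ l₁₃ t ρ : ℚ) : ℝ) =
      capMinorant y₀ y₁ y₂ y₃ p₀ p₁ l₀₁ l₁₁ l₀₂ l₁₂ l₀₃ l₁₃ t ρ := by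
  simp only [capMinorantQ, capMinorant]; push_cast; ring

/-! ## §108B.2 One six-column representation bounds the roof (tree E8, families spelled out) -/

/-- ★ A representation of `W` by six relabelled table rows with non-negative multipliers bounds `roofVal T75 W` by its value
(`roofVal_T75_le_of_repr` with the `Fin 6` families written as six explicit columns — the shape a rational corner certificate is read in). -/
theorem roofVal_T75_le_six {W : Fin 3 × Bool → ℝ} {e₀ e₁ e₂ e₃ e₄ e₅ : (Fin 3 × Bool → ℝ) × ℝ}
    (h₀ : e₀ ∈ T75) (h₁ : e₁ ∈ T75) (h₂ : e₂ ∈ T75) (h₃ : e₃ ∈ T75) (h₄ : e₄ ∈ T75) (h₅ : e₅ ∈ T75)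
    (g₀ g₁ g₂ g₃ g₄ g₅ : Fin 6) (σ₀ σ₁ σ₂ σ₃ σ₄ σ₅ : Fin 8) {l₀ l₁ l₂ l₃ l₄ l₅ : ℝ}
    (hl₀ : 0 ≤ l₀) (hl₁ : 0 ≤ l₁) (hl₂ : 0 ≤ l₂) (hl₃ : 0 ≤ l₃) (hl₄ : 0 ≤ l₄) (hl₅ : 0 ≤ l₅)
    (hW : ∀ p, W p = l₀ * e₀.1 (relabel g₀ σ₀ p) + l₁ * e₁.1 (relabel g₁ σ₁ p) + l₂ * e₂.1 (relabel g₂ σ₂ p) +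
      l₃ * e₃.1 (relabel g₃ σ₃ p) + l₄ * e₄.1 (relabel g₄ σ₄ p) + l₅ * e₅.1 (relabel g₅ σ₅ p)) :
    roofVal T75 W ≤ l₀ * e₀.2 + l₁ * e₁.2 + l₂ * e₂.2 + l₃ * e₃.2 + l₄ * e₄.2 + l₅ * e₅.2 := by
  have h := roofVal_T75_le_of_repr (Wv := W) ![e₀, e₁, e₂, e₃, e₄, e₅] ![g₀, g₁, g₂, g₃, g₄, g₅] ![σ₀, σ₁, σ₂, σ₃, σ₄, σ₅]
    ![l₀, l₁, l₂, l₃, l₄, l₅] ?_ ?_ ?_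
  · simpa [Fin.sum_univ_succ, add_assoc] using h
  · intro i; fin_cases i
    exacts [h₀, h₁, h₂, h₃, h₄, h₅]
  · intro i; fin_cases i
    exacts [hl₀, hl₁, hl₂, hl₃, hl₄, hl₅]
  · intro p; rw [hW p]; simp [Fin.sum_univ_succ, add_assoc]

/-! ## §108B.3 The cap side of a cell on one axis: rational checks and their soundness -/

/-- `Rat.cast` is monotone (the one bookkeeping step of every soundness lemma below). [formal bookkeeping] -/
theorem qle {a b : ℚ} (h : a ≤ b) : (a : ℝ) ≤ b := Rat.cast_le.mpr h

/-- [formal bookkeeping] strict version. -/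
theorem qlt {a b : ℚ} (h : a < b) : (a : ℝ) < b := Rat.cast_lt.mpr h

/-- NODE 99 cell geometry `CapCellGeom` as a rational check. -/
def capGeomCheck (ρ₀ ρ₁ a lo hi dlo dhi : ℚ) : Bool :=
  decide (0 ≤ ρ₀ ∧ ρ₀ ≤ ρ₁ ∧ ρ₁ ≤ a ∧ a < lo ∧ lo < hi ∧ 80 ≤ dlo ∧ dlo < dhi ∧ dhi ≤ 134 ∧ dlo ≤ lo - ρ₁ ∧ hi - ρ₀ ≤ dhi)

/-- Soundness of `capGeomCheck`. -/
theorem capGeomCheck_sound {ρ₀ ρ₁ a lo hi dlo dhi : ℚ} (h : capGeomCheck ρ₀ ρ₁ a lo hi dlo dhi = true) :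
    CapCellGeom ρ₀ ρ₁ a lo hi dlo dhi := by
  obtain ⟨h0, h1, h2, h3, h4, h5, h6, h7, h8, h9⟩ := decide_eq_true_eq.mp h
  refine ⟨by exact_mod_cast h0, qle h1, qle h2, qlt h3, qlt h4, by exact_mod_cast h5, qlt h6, by exact_mod_cast h7, ?_, ?_⟩
  · exact_mod_cast h8
  · exact_mod_cast h9

/-- NODE 99 pole row `PoleRowCert` as a rational check (two exact `φ` evaluations). -/
def poleRowCheck (dlo dhi p₀ p₁ : ℚ) : Bool :=
  decide (depthProfileQ 160 dlo ≤ p₀ + p₁ * dlo ∧ depthProfileQ 160 dhi ≤ p₀ + p₁ * dhi)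

/-- Soundness of `poleRowCheck`. -/
theorem poleRowCheck_sound {dlo dhi p₀ p₁ : ℚ} (h : poleRowCheck dlo dhi p₀ p₁ = true) :
    PoleRowCert dlo dhi p₀ p₁ := by
  obtain ⟨h0, h1⟩ := decide_eq_true_eq.mp h
  refine ⟨?_, ?_⟩
  · have := qle h0; rw [cast_depthProfileQ] at this; push_cast at this; exact this
  · have := qle h1; rw [cast_depthProfileQ] at this; push_cast at this; exact this

/-- NODE 99 tilt row `TiltRowCert c` as a rational check (fourteen closed inequalities; two exact `φ` evaluations at the certified
square-root brackets `rA`, `rL`). -/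
def tiltRowCheck (c ρ₀ ρ₁ a lo hi rA uA rL lL l₀ l₁ : ℚ) : Bool :=
  decide (0 ≤ rA ∧ 0 ≤ rL ∧ tiltArgQ c ρ₀ a ≤ rA ^ 2 ∧ tiltArgQ c ρ₁ a ≤ rA ^ 2 ∧
    rL ^ 2 ≤ tiltArgQ c ρ₀ lo ∧ rL ^ 2 ≤ tiltArgQ c ρ₀ lo + (lo * (2 * c - 2) + 2 * ρ₀ * (3 - 2 * c)) * (ρ₁ - ρ₀) ∧
    6400 ≤ tiltArgQ c ρ₀ a ∧ 6400 ≤ tiltArgQ c ρ₀ a + (a * (2 * c - 2) + 2 * ρ₀ * (3 - 2 * c)) * (ρ₁ - ρ₀) ∧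
    tiltArgQ c ρ₀ hi ≤ 17956 ∧ tiltArgQ c ρ₁ hi ≤ 17956 ∧
    depthProfileQ 160 rA ≤ uA ∧ lL ≤ depthProfileQ 160 rL ∧
    l₀ + l₁ * lo ≤ lL ∧ l₀ + l₁ * hi ≤ uA * (1 - (hi - a) / (lo - a)) + lL * ((hi - a) / (lo - a)))

/-- Soundness of `tiltRowCheck` (the real constant `c'` is the cast of `c`, supplied as `hc` so that NODE 99's literals `439/485`, … match). -/
theorem tiltRowCheck_sound {c ρ₀ ρ₁ a lo hi rA uA rL lL l₀ l₁ : ℚ} {c' : ℝ} (hc : (c : ℝ) = c')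
    (h : tiltRowCheck c ρ₀ ρ₁ a lo hi rA uA rL lL l₀ l₁ = true) : TiltRowCert c' ρ₀ ρ₁ a lo hi rA uA rL lL l₀ l₁ := by
  subst hc
  obtain ⟨h0, h1, h2, h3, h4, h5, h6, h7, h8, h9, h10, h11, h12, h13⟩ := decide_eq_true_eq.mp h
  refine ⟨by exact_mod_cast h0, by exact_mod_cast h1, ?_, ?_, ?_, ?_, ?_, ?_, ?_, ?_, ?_, ?_, ?_, ?_⟩
  · have := qle h2; rw [cast_tiltArgQ] at this; push_cast at this; exact this
  · have := qle h3; rw [cast_tiltArgQ] at this; push_cast at this; exact this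
  · have := qle h4; rw [cast_tiltArgQ] at this; push_cast at this; exact this
  · have := qle h5; push_cast [cast_tiltArgQ] at this; exact this
  · have := qle h6; rw [cast_tiltArgQ] at this; push_cast at this; exact this
  · have := qle h7; push_cast [cast_tiltArgQ] at this; exact this
  · have := qle h8; rw [cast_tiltArgQ] at this; push_cast at this; exact this
  · have := qle h9; rw [cast_tiltArgQ] at this; push_cast at this; exact this
  · have := qle h10; rw [cast_depthProfileQ] at this; push_cast at this; exact this
  · have := qle h11; rw [cast_depthProfileQ] at this; push_cast at this; exact this
  · exact_mod_cast h12
  · exact_mod_cast h13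

end Summit.AtomisticToContinuum.Crystallization.Theorems.ChargedEnergyGapChartDial
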